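import Mathlib
import Literature.Combinatorics.Additive.TripleProductProperty
import Literature.Barriers.MatrixMultiplication.QuasirandomBarrier
import Literature.Barriers.MatrixMultiplication.QuasirandomBarrierProofs
import Literature.Barriers.MatrixMultiplication.YoungSubgroupBarrierSTPP
import Summits.MatrixMultiplication.MatrixMultiplication.Theses.LevelGradedCohnUmans
import Summits.MatrixMultiplication.MatrixMultiplication.Theorems.LevelGradedCohnUmansSepImpliesTPP

/-!
# `GradedDesignFamily` (crux stmt-MatrixMultiplication-7610), line `quadratic-extension-level-one-cell`:
# the SLICED HORN of the closer `stub_subfieldCell` is dead (negative-side support, lead c2)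

The closer S3 of the line asks for level-one separated triples `(φ(SL₂ k), Y, Z)` in `GL₂(K)`,
`|K| = |k|² = Q`, with `|Y|, |Z| ≥ c·Q^{3/2}`.  Its card keeps two horns open: designs inside
determinant slices of `GL₂(K)` ("sliced horn": `det` constant on `Y` and on `Z`, so that the footprint
folds into one `SL₂(K)`-coset) and designs spread over `GL₂(K)`.  This file kills the first horn for
every field, by the tree's PROVED quasirandomness barrier (Blasiak–Cohn–Grochow–Pratt–Umans 2023,
Thm 3.2, `BCGPU2023_thm32_holds`) applied to the nonabelian group `SL₂(K)`:

* `slicedHorn_card_mul_le` — if `(X, Y, Z)` has the triple product property in `GL₂(K)`, `X` consists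
  of matrices of determinant `1`, and `det` is constant on `Y` and constant on `Z`, then
  `|X||Y||Z| ≤ |SL₂(K)|^{3/2}/√n(SL₂ K) + |SL₂(K)|`, `n` = `secondCharDegree` (right-translate `Y`, `Z`
  into `SL₂(K)` — the TPP only sees right quotients, `tripleProductProperty_image_mul_right_iff` — pull
  the three sets back along the injective hom `SpecialLinearGroup.toGL`, and apply Thm 3.2 there);
* `slicedHorn_card_mul_le_of_sep` — the same for the crux's `J`-separation clause (any test space `J`),
  through the proved route item `SepImpliesTPP`;
* `slicedHorn_card_mul_le_of_minDegree` — with the classical value `n(SL₂(F_Q)) ≥ (Q−1)/2`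
  (Frobenius 1896 / Schur 1907; the least degree of a non-linear irreducible character of `SL₂(F_Q)` is
  `(Q−1)/gcd(2,Q−1)`) supplied as a HYPOTHESIS (it is not in the tree), the bound reads
  `|X||Y||Z| ≤ √2·|SL₂ K|^{3/2}/√(Q−1) + |SL₂ K| ≈ √2·Q⁴`, incompatible with the sliced horn's
  `|X||Y||Z| ≥ (q³−q)·c²·Q³ ≈ c²Q^{9/2}` as soon as `Q > 2/c⁴`: S3 witnesses must be SPREAD over the
  determinant classes (lead's assessment `Cruxes/GradedDesignFamily/Lines/quadratic-extension-level-one-cell-S3.md`, §1).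

Everything is `sorry`-free; axioms `propext`, `Classical.choice`, `Quot.sound`.
-/

set_option linter.dupNamespace false

noncomputable section

open scoped BigOperators
open Literature.Combinatorics.Additive Literature.Barriers.MatrixMultiplication
  Literature.RepresentationTheory.FiniteGroups

namespace Summit.MatrixMultiplication.MatrixMultiplication.Theorems.GradedDesignFamily.Negative

/-! ## Transport of the triple product property along an injective homomorphism -/

/-- The triple product property pulls back along an injective group homomorphism: if the images
`f '' S, f '' T, f '' U` have it then so do `S, T, U`. [folklore] -/
theorem slicedHorn_tpp_of_image {G G' : Type*} [Group G] [Group G'] [DecidableEq G']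
    (f : G →* G') (hf : Function.Injective f) {S T U : Finset G}
    (h : TripleProductProperty (S.image f) (T.image f) (U.image f)) : TripleProductProperty S T U := by
  intro s hs s' hs' t ht t' ht' u hu u' hu' he
  have he' : f s * (f s')⁻¹ * (f t * (f t')⁻¹) * (f u * (f u')⁻¹) = 1 := by
    rw [← map_inv, ← map_inv, ← map_inv, ← map_mul, ← map_mul, ← map_mul, ← map_mul, ← map_mul,
      he, map_one]
  obtain ⟨h1, h2, h3⟩ := h (f s) (Finset.mem_image_of_mem f hs) (f s') (Finset.mem_image_of_mem f hs')
    (f t) (Finset.mem_image_of_mem f ht) (f t') (Finset.mem_image_of_mem f ht')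
    (f u) (Finset.mem_image_of_mem f hu) (f u') (Finset.mem_image_of_mem f hu') he'
  exact ⟨hf h1, hf h2, hf h3⟩

/-! ## `SL₂(K)` is nonabelian -/

section SL2

variable (K : Type) [Field K] [Fintype K] [DecidableEq K]

omit [Fintype K] [DecidableEq K] in
/-- `SL₂(K)` is nonabelian for every field `K`: the two elementary transvections do not commute
(their products differ in the `(0,0)` entry: `2 ≠ 1`). [folklore] -/
theorem slicedHorn_sl2_nonabelian :
    ∃ a b : Matrix.SpecialLinearGroup (Fin 2) K, a * b ≠ b * a := by
  refine ⟨⟨!![1, 1; 0, 1], by simp [Matrix.det_fin_two_of]⟩,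
    ⟨!![1, 0; 1, 1], by simp [Matrix.det_fin_two_of]⟩, fun h => ?_⟩
  have h00 := congrArg (fun M : Matrix.SpecialLinearGroup (Fin 2) K => (M : Matrix (Fin 2) (Fin 2) K) 0 0) h
  simp [Matrix.mul_apply, Fin.sum_univ_two] at h00

omit [Fintype K] [DecidableEq K] in
/-- Elements of `GL₂(K)` of determinant `1` come from `SL₂(K)`. [folklore] -/
theorem slicedHorn_exists_toGL_eq {g : Matrix.GeneralLinearGroup (Fin 2) K}
    (hg : Matrix.GeneralLinearGroup.det g = 1) :
    ∃ A : Matrix.SpecialLinearGroup (Fin 2) K, Matrix.SpecialLinearGroup.toGL A = g := by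
  have hdet : (g : Matrix (Fin 2) (Fin 2) K).det = 1 := by
    rw [← Matrix.GeneralLinearGroup.val_det_apply, hg, Units.val_one]
  exact ⟨⟨(g : Matrix (Fin 2) (Fin 2) K), hdet⟩, Units.ext rfl⟩

/-- Pull-back of a finite set of determinant-one elements of `GL₂(K)` to `SL₂(K)`: same image,
same cardinality. [folklore] -/
theorem slicedHorn_exists_preimage (X : Finset (Matrix.GeneralLinearGroup (Fin 2) K))
    (hX : ∀ x ∈ X, Matrix.GeneralLinearGroup.det x = 1) :
    ∃ X' : Finset (Matrix.SpecialLinearGroup (Fin 2) K),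
      X'.image Matrix.SpecialLinearGroup.toGL = X ∧ X'.card = X.card := by
  classical
  refine ⟨Finset.univ.filter (fun A => Matrix.SpecialLinearGroup.toGL A ∈ X), ?_, ?_⟩
  · ext g
    simp only [Finset.mem_image, Finset.mem_filter, Finset.mem_univ, true_and]
    constructor
    · rintro ⟨A, hA, rfl⟩; exact hA
    · intro hg
      obtain ⟨A, rfl⟩ := slicedHorn_exists_toGL_eq K (hX g hg)
      exact ⟨A, hg, rfl⟩
  · have himg : (Finset.univ.filter (fun A => Matrix.SpecialLinearGroup.toGL A ∈ X)).image
        Matrix.SpecialLinearGroup.toGL = X := by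
      ext g
      simp only [Finset.mem_image, Finset.mem_filter, Finset.mem_univ, true_and]
      constructor
      · rintro ⟨A, hA, rfl⟩; exact hA
      · intro hg
        obtain ⟨A, rfl⟩ := slicedHorn_exists_toGL_eq K (hX g hg)
        exact ⟨A, hg, rfl⟩
    conv_rhs => rw [← himg]
    rw [Finset.card_image_of_injective _ Matrix.SpecialLinearGroup.toGL_injective]

/-! ## The sliced horn is capped by the quasirandomness of `SL₂(K)` -/

/-- **Sliced designs live in `SL₂(K)` and are capped by its quasirandomness.**  If `(X, Y, Z)` has the
triple product property in `GL₂(K)`, every element of `X` has determinant `1`, and `det` is constant on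
`Y` and constant on `Z`, then `|X||Y||Z| ≤ |SL₂(K)|^{3/2}/√n(SL₂ K) + |SL₂(K)|` with
`n = secondCharDegree` (BCGPU 2023, Thm 3.2, applied inside `SL₂(K)` after right-translating `Y` and `Z`
into it).  [cite: BlasiakCohnGrochowPrattUmans2023, Thm. 3.2] -/
theorem slicedHorn_card_mul_le : ∀ (K : Type) [Field K] [Fintype K] [DecidableEq K] (X Y Z : Finset (Matrix.GeneralLinearGroup (Fin 2) K)), Literature.Combinatorics.Additive.TripleProductProperty X Y Z → (∀ x ∈ X, Matrix.GeneralLinearGroup.det x = 1) → (∀ y ∈ Y, ∀ y' ∈ Y, Matrix.GeneralLinearGroup.det y = Matrix.GeneralLinearGroup.det y') → (∀ z ∈ Z, ∀ z' ∈ Z, Matrix.GeneralLinearGroup.det z = Matrix.GeneralLinearGroup.det z') → ((X.card * Y.card * Z.card : ℕ) : ℝ) ≤ (Fintype.card (Matrix.SpecialLinearGroup (Fin 2) K) : ℝ) ^ (3 / 2 : ℝ) / Real.sqrt (Literature.Barriers.MatrixMultiplication.secondCharDegree (Matrix.SpecialLinearGroup (Fin 2) K)) + Fintype.card (Matrix.SpecialLinearGroup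 (Fin 2) K) := by
  intro K _ _ _ X Y Z hT hX hY hZ
  classical
  -- empty `Y` or `Z`: the volume is `0`
  have hRHS : (0 : ℝ) ≤ (Fintype.card (Matrix.SpecialLinearGroup (Fin 2) K) : ℝ) ^ (3 / 2 : ℝ) /
      Real.sqrt (secondCharDegree (Matrix.SpecialLinearGroup (Fin 2) K)) +
        Fintype.card (Matrix.SpecialLinearGroup (Fin 2) K) := by positivity
  rcases Y.eq_empty_or_nonempty with hYe | ⟨y₀, hy₀⟩
  · simp [hYe, hRHS]
  rcases Z.eq_empty_or_nonempty with hZe | ⟨z₀, hz₀⟩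
  · simp [hZe, hRHS]
  -- translate `Y`, `Z` into the determinant-one slice
  set Y₁ := Y.image (· * y₀⁻¹) with hY₁
  set Z₁ := Z.image (· * z₀⁻¹) with hZ₁
  have hT₁ : TripleProductProperty X Y₁ Z₁ := by
    have hX1 : X.image (· * (1 : Matrix.GeneralLinearGroup (Fin 2) K)) = X := by
      simp only [mul_one, Finset.image_id']
    have := (tripleProductProperty_image_mul_right_iff X Y Z 1 y₀⁻¹ z₀⁻¹).2 hT
    rwa [hX1] at this
  have hY₁det : ∀ y ∈ Y₁, Matrix.GeneralLinearGroup.det y = 1 := by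
    intro y hy
    obtain ⟨y', hy', rfl⟩ := Finset.mem_image.1 hy
    rw [map_mul, map_inv, hY y' hy' y₀ hy₀, mul_inv_cancel]
  have hZ₁det : ∀ z ∈ Z₁, Matrix.GeneralLinearGroup.det z = 1 := by
    intro z hz
    obtain ⟨z', hz', rfl⟩ := Finset.mem_image.1 hz
    rw [map_mul, map_inv, hZ z' hz' z₀ hz₀, mul_inv_cancel]
  have hcY : Y₁.card = Y.card := Finset.card_image_of_injective _ (mul_left_injective _)
  have hcZ : Z₁.card = Z.card := Finset.card_image_of_injective _ (mul_left_injective _)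
  -- pull back to `SL₂(K)`
  obtain ⟨X', hX'i, hX'c⟩ := slicedHorn_exists_preimage K X hX
  obtain ⟨Y', hY'i, hY'c⟩ := slicedHorn_exists_preimage K Y₁ hY₁det
  obtain ⟨Z', hZ'i, hZ'c⟩ := slicedHorn_exists_preimage K Z₁ hZ₁det
  have hT' : TripleProductProperty X' Y' Z' := by
    refine slicedHorn_tpp_of_image Matrix.SpecialLinearGroup.toGL
      Matrix.SpecialLinearGroup.toGL_injective ?_
    rw [hX'i, hY'i, hZ'i]; exact hT₁
  have h32 := BCGPU2023_thm32_holds (Matrix.SpecialLinearGroup (Fin 2) K)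
    (slicedHorn_sl2_nonabelian K) X' Y' Z' hT'
  rw [hX'c, hY'c, hZ'c, hcY, hcZ] at h32
  exact h32

/-- **The sliced horn of the crux's separation clause.**  If `(X, Y, Z) ⊆ GL₂(K)` is `J`-separated in
the sense of `GradedDesignFamily` (for ANY set `J` of test functions), `X` lies in the
determinant-one slice and `det` is constant on `Y` and on `Z`, then
`|X||Y||Z| ≤ |SL₂(K)|^{3/2}/√n(SL₂ K) + |SL₂(K)|` (separation implies the TPP: route item
`SepImpliesTPP`, proved as `SepImpliesTPP_proof`). [cite: BlasiakCohnGrochowPrattUmans2023, Thm. 3.2] -/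
theorem slicedHorn_card_mul_le_of_sep (J : Set (Matrix.GeneralLinearGroup (Fin 2) K → ℂ))
    (X Y Z : Finset (Matrix.GeneralLinearGroup (Fin 2) K))
    (hsep : ∀ x₀ ∈ X, ∀ z₀ ∈ Z, ∃ f ∈ J, ∀ x ∈ X, ∀ y ∈ Y, ∀ y' ∈ Y, ∀ z ∈ Z,
      (x = x₀ ∧ y = y' ∧ z = z₀ → f (x⁻¹ * y * y'⁻¹ * z) = 1) ∧
      (¬ (x = x₀ ∧ y = y' ∧ z = z₀) → f (x⁻¹ * y * y'⁻¹ * z) = 0))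
    (hX : ∀ x ∈ X, Matrix.GeneralLinearGroup.det x = 1)
    (hY : ∀ y ∈ Y, ∀ y' ∈ Y, Matrix.GeneralLinearGroup.det y = Matrix.GeneralLinearGroup.det y')
    (hZ : ∀ z ∈ Z, ∀ z' ∈ Z, Matrix.GeneralLinearGroup.det z = Matrix.GeneralLinearGroup.det z') :
    ((X.card * Y.card * Z.card : ℕ) : ℝ) ≤
      (Fintype.card (Matrix.SpecialLinearGroup (Fin 2) K) : ℝ) ^ (3 / 2 : ℝ) /
          Real.sqrt (secondCharDegree (Matrix.SpecialLinearGroup (Fin 2) K)) +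
        Fintype.card (Matrix.SpecialLinearGroup (Fin 2) K) :=
  slicedHorn_card_mul_le K X Y Z
    (Summit.MatrixMultiplication.MatrixMultiplication.Theorems.SepImpliesTPP_proof _ J X Y Z hsep)
    hX hY hZ

/-- **Quantitative form under the classical minimal degree of `SL₂`.**  Supplying, as a hypothesis,
the classical fact that every non-linear irreducible character of `SL₂(F_Q)` has degree `≥ (Q−1)/2`
(Frobenius 1896 for `PSL₂(p)`, Schur 1907 / Jordan 1907 for `SL₂(q)`: the least such degree is
`(Q−1)/gcd(2, Q−1)`), a sliced TPP triple has `|X||Y||Z| ≤ √2·|SL₂ K|^{3/2}/√(Q−1) + |SL₂ K|`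
(`≈ √2·Q⁴`), whereas the sliced horn of `stub_subfieldCell` needs `(q³−q)·c²·Q³ ≈ c²·Q^{9/2}`.
[cite: BlasiakCohnGrochowPrattUmans2023, Thm. 3.2] -/
theorem slicedHorn_card_mul_le_of_minDegree (X Y Z : Finset (Matrix.GeneralLinearGroup (Fin 2) K))
    (hT : TripleProductProperty X Y Z)
    (hX : ∀ x ∈ X, Matrix.GeneralLinearGroup.det x = 1)
    (hY : ∀ y ∈ Y, ∀ y' ∈ Y, Matrix.GeneralLinearGroup.det y = Matrix.GeneralLinearGroup.det y')
    (hZ : ∀ z ∈ Z, ∀ z' ∈ Z, Matrix.GeneralLinearGroup.det z = Matrix.GeneralLinearGroup.det z')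
    (hQ : 1 < Fintype.card K)
    (hn : ((Fintype.card K : ℝ) - 1) / 2 ≤ secondCharDegree (Matrix.SpecialLinearGroup (Fin 2) K)) :
    ((X.card * Y.card * Z.card : ℕ) : ℝ) ≤
      Real.sqrt 2 * (Fintype.card (Matrix.SpecialLinearGroup (Fin 2) K) : ℝ) ^ (3 / 2 : ℝ) /
          Real.sqrt ((Fintype.card K : ℝ) - 1) +
        Fintype.card (Matrix.SpecialLinearGroup (Fin 2) K) := by
  have h := slicedHorn_card_mul_le K X Y Z hT hX hY hZ
  set N : ℝ := (Fintype.card (Matrix.SpecialLinearGroup (Fin 2) K) : ℝ) with hN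
  set n : ℝ := (secondCharDegree (Matrix.SpecialLinearGroup (Fin 2) K) : ℝ) with hn'
  have hQ1 : (0 : ℝ) < (Fintype.card K : ℝ) - 1 := by
    have : (1 : ℝ) < Fintype.card K := by exact_mod_cast hQ
    linarith
  have hnpos : 0 < n := lt_of_lt_of_le (by positivity) hn
  have hN0 : 0 ≤ N ^ (3 / 2 : ℝ) := by positivity
  -- √n ≥ √((Q-1)/2) = √(Q-1)/√2
  have hsq : Real.sqrt ((Fintype.card K : ℝ) - 1) / Real.sqrt 2 ≤ Real.sqrt n := by
    rw [← Real.sqrt_div hQ1.le]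
    exact Real.sqrt_le_sqrt hn
  have hpos2 : 0 < Real.sqrt ((Fintype.card K : ℝ) - 1) / Real.sqrt 2 := by positivity
  calc ((X.card * Y.card * Z.card : ℕ) : ℝ) ≤ N ^ (3 / 2 : ℝ) / Real.sqrt n + N := h
    _ ≤ N ^ (3 / 2 : ℝ) / (Real.sqrt ((Fintype.card K : ℝ) - 1) / Real.sqrt 2) + N := by
        gcongr
    _ = Real.sqrt 2 * N ^ (3 / 2 : ℝ) / Real.sqrt ((Fintype.card K : ℝ) - 1) + N := by
        rw [div_div_eq_mul_div, mul_comm]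

end SL2

end Summit.MatrixMultiplication.MatrixMultiplication.Theorems.GradedDesignFamily.Negative

end
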